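import Literature.AnabelianGeometry.EtaleTheta.Discharge.Sec2CuspStabModel
import Literature.AnabelianGeometry.EtaleTheta.Discharge.Sec2Rmk261OfSetting
import HarnessLib

/-!
# [EtTh] Cor. 2.9 AT THE §1 MODEL — the labels of cusps for the assembled cover, with `hΘ` and `hC1`
# DISCHARGED and `hC2` reduced to a print-shaped origin clause (proof-only companion)

Mochizuki, *The étale theta function and its Frobenioid-theoretic manifestations*, Publ. RIMS **45**
(2009), §2: Cor. 2.9 p. 43 (labels of cusps `∈ (ℤ/lℤ)^±` ↔ `Aut_K(−)`-orbits of cusps), Rmk. 2.6.1 p. 40,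
Def. 2.1 p. 35–36 [cite: MochizukiEtTh2009, Cor 2.9 p.43].

Cell abc-iut, layer L2, seat abc-iut-L2-d3 (gen 5); W3-L2-02 residue, node EtTh:Cor2.9 at the ARITHMETIC
model `T := MuTwoSetting.CLevelData.temperedCoverData …` (ThetaCoversTemperedOfSetting, p429967). PROOF-ONLY
(0 defs, no new `Prop` fact). The generic discharges of this lineage over an abstract
`T : TemperedCoverData l` — `cor29_card_undotted_of (hΘ hC1 hC2)` (gen 2), `cor29_card_of (hslim h26 hΘ hC1
hC2)` (gen 3) — carried the binders `hΘ` (GAP-LEDGER G-L2d3-1) and `hC1`/`hC2` (G-L2d3-2), none a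
consequence of abc-iut-L2-t2's interface (kernel certificates `ThetaCoversAbelianWitness`, abc-iut-w5-d118's
`not_forall_hC1`). AT THE MODEL: `hΘ` HOLDS (abc-iut-L2-t11's `coverDataAx_hTheta`; abc-iut-f-144's
`temperedCoverData_hTheta` / `rmk261_ofSetting`, `Sec2Rmk261OfSetting`), `hC1` HOLDS for compact `D_x`
modulo [SemiAnbd] Thm. 6.5 (ii) (`Sec2CuspStabModel.temperedCoverData_hC1`), and here:

* `temperedCoverData_hC2_of_normalizes` — `hC2` ⟸ the print-shaped ORIGIN clause «some element of
  `Π^tp_C ∖ Π^tp_X` normalises `inclX(D_x)`» (the inversion of `C = X/±1` fixes the unique cusp of `X`,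
  Def. 2.1 p. 36: "relative to choosing the unique cusp of `X` as origin"), for compact `D_x`;
* **`temperedCoverData_cor29_card_undotted'`** — [EtTh] Cor. 2.9 for `X̲̲, C̲, C̲̲` at the model with `hΘ`,
  `hC1` DISCHARGED: residual = {the origin clause, compact `D_x` (⟸ a continuous section of `D_x ↠ G_K`,
  `isCompact_decomp_of_section`), [SemiAnbd] Thm. 6.5 (ii) `DecompCommensurablyTerminal` = F-1658 BY NAME,
  and `HasMuL` = "`μ_l ⊆ K`", part of the printed statement};
* **`temperedCoverData_cor29_card`** / `…_of_section` — abc-iut-L2-t2's typed node `TemperedCoverData.Cor29_card`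
  (all six members `Ẋ̲̲, Ċ̲, Ċ̲̲, X̲̲, C̲, C̲̲`) for the assembled cover, additionally modulo slimness of `Π^tp_C`
  ([SemiAnbd] §3) and Prop. 2.6 (`T.Prop26`, FACT-LIST F-0610) BY NAME — exactly the inputs print invokes.

* v1.1: `exists_not_mem_range_mem_normalizer_decomp` — the origin clause above DERIVED from «`X^log` has a UNIQUE
  cusp» (type `(1,1)`) and [SemiAnbd] Thm. 6.5 (iii) `IsoPreservesCuspidalDecomp` (F-1674) applied to `conjX ε_±`;
  `temperedCoverData_hC2`, **`temperedCoverData_cor29_card'`** / `…_of_section'` — Cor. 2.9 at the model with EVERY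
  cusp hypothesis reduced to NAMED facts (F-1658, F-1674, F-0610, slimness) + «unique cusp» + compact `D_x`.

HONEST FRAMING: nothing asserts that a `MuTwoSetting`, a `CLevelData` or a section exists; [EtTh]/[SemiAnbd]
are refereed; no side is taken on [IUTchIII] Cor. 3.12; typed ≠ proved elsewhere.
-/

namespace Literature.AnabelianGeometry.EtaleTheta

open Literature.AnabelianGeometry.SemiGraphs ThetaCovers
open Literature.AlgebraicGeometry.Frobenioids (IsSlimGroup)
open _root_.Topology
open scoped Pointwise

namespace MuTwoSetting.CLevelData

variable {p : ℕ} [Fact p.Prime] {M : MuTwoSetting p}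
variable {PC : Type} [Group PC] [TopologicalSpace PC] [IsTopologicalGroup PC] [T2Space PC]

section Binders

variable (e : M.CLevelData) (ιC : M.GtpC →ₜ* PC)
    (hιC : IsProfiniteCompletion ιC) (hinj : Function.Injective ιC) (op : M.toThetaSetting.OncePuncturedData)
    {l : ℕ} (hodd : Odd l) {x : M.Pt} (hx : M.IsCusp x)
    (hIx : ((e.piCDataOf ιC hιC).Dx x ⊓ (e.piCDataOf ιC hιC).augGK.ker) ⊔ (e.piCDataOf ιC hιC).barKer l =
      (e.piCDataOf ιC hιC).barTheta l)
    (hιell : ∀ c ∈ (e.piCDataOf ιC hιC).augGK.ker, c ∉ (e.piCDataOf ιC hιC).PiX →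
      ∀ d ∈ (e.piCDataOf ιC hιC).PiX ⊓ (e.piCDataOf ιC hιC).augGK.ker,
        c * d * c⁻¹ * d ∈ (e.piCDataOf ιC hιC).barTheta l)
    (hN : ((M.GtpXu l).map M.inclX).Normal) (hY : (M.GtpY.map M.inclX).Normal) {S : Subgroup PC}
    (hS : ((e.piCDataOf ιC hιC).coverDataAx l op hx hodd hIx hιell
        ((e.piCDataOf ιC hιC).inv_theta_of_inv_ell l op hιell)).toCoverData.IsSplitting S)
    (hSc : IsClosed (S : Set PC))

/-- **`hC2` at the model from the origin clause «the inversion of `C` fixes the cusp»**: if some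
`g ∈ Π^tp_C ∖ Π^tp_X` normalises `inclX(D_x)` (compact `D_x`), then the cusp stabiliser is not inside
`Π^tp_X`. [cite: MochizukiEtTh2009, Def 2.1 p.36] -/
theorem temperedCoverData_hC2_of_normalizes (hDc : IsCompact (M.decomp x : Set M.PiTemp))
    (hfix : ∃ g : M.GtpC, g ∉ M.inclX.range ∧
      g ∈ Subgroup.normalizer (((M.decomp x).map M.inclX : Subgroup M.GtpC) : Set M.GtpC)) :
    ¬ (e.temperedCoverData ιC hιC hinj op hodd hx hIx hιell hN hY hS hSc).cuspStabC ≤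
      (e.temperedCoverData ιC hιC hinj op hodd hx hIx hιell hN hY hS hSc).tp
        (e.temperedCoverData ιC hιC hinj op hodd hx hIx hιell hN hY hS hSc).PiX := by
  obtain ⟨g, hgX, hgN⟩ := hfix
  rw [temperedCoverData_cuspStabC e ιC hιC hinj op hodd hx hIx hιell hN hY hS hSc hDc,
    temperedCoverData_tp_PiX e ιC hιC hinj op hodd hx hIx hιell hN hY hS hSc]
  exact fun h => hgX (h hgN)

/-- **[EtTh] Cor. 2.9 for `X̲̲, C̲, C̲̲` at the arithmetic model, `hΘ` and `hC1` DISCHARGED**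
(`#(Aut_K(−)-orbits of cusps) = (l+1)/2` when `μ_l ⊆ K`): residual inputs = the origin clause
«the inversion of `C` fixes the cusp», compact `D_x`, [SemiAnbd] Thm. 6.5 (ii) BY NAME.
[cite: MochizukiEtTh2009, Cor 2.9 p.43] -/
theorem temperedCoverData_cor29_card_undotted' (hDc : IsCompact (M.decomp x : Set M.PiTemp))
    (h65 : M.toTemperedCurve.DecompCommensurablyTerminal)
    (hfix : ∃ g : M.GtpC, g ∉ M.inclX.range ∧
      g ∈ Subgroup.normalizer (((M.decomp x).map M.inclX : Subgroup M.GtpC) : Set M.GtpC)) :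
    (e.temperedCoverData ιC hιC hinj op hodd hx hIx hιell hN hY hS hSc).HasMuL →
      ∀ S' ∈ [(e.temperedCoverData ιC hιC hinj op hodd hx hIx hιell hN hY hS hSc).tp
          (e.temperedCoverData ιC hιC hinj op hodd hx hIx hιell hN hY hS hSc).PiXuu,
        (e.temperedCoverData ιC hιC hinj op hodd hx hIx hιell hN hY hS hSc).tp
          (e.temperedCoverData ιC hιC hinj op hodd hx hIx hιell hN hY hS hSc).PiCu,
        (e.temperedCoverData ιC hιC hinj op hodd hx hIx hιell hN hY hS hSc).tp
          (e.temperedCoverData ιC hιC hinj op hodd hx hIx hιell hN hY hS hSc).PiCuu],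
      Nat.card ((e.temperedCoverData ιC hιC hinj op hodd hx hIx hιell hN hY hS hSc).cuspOrbits S') =
        (l + 1) / 2 :=
  temperedCoverData_cor29_card_undotted e ιC hιC hinj op hodd hx hIx hιell hN hY hS hSc hDc h65
    (temperedCoverData_hTheta e ιC hιC hinj op hodd hx hIx hιell hN hY hS hSc)
    (temperedCoverData_hC2_of_normalizes e ιC hιC hinj op hodd hx hIx hιell hN hY hS hSc hDc hfix)

/-- **[EtTh] Cor. 2.9 (all six members `Ẋ̲̲, Ċ̲, Ċ̲̲, X̲̲, C̲, C̲̲`) at the arithmetic model, `hΘ` and `hC1`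
DISCHARGED** — abc-iut-L2-t2's typed node `TemperedCoverData.Cor29_card` for the assembled cover, by
abc-iut-L2-d3 (gen 3)'s `cor29_card_of`; residual inputs BY NAME: slimness of `Π^tp_C`, Prop. 2.6 (F-0610),
the origin clause «the inversion of `C` fixes the cusp», compact `D_x`, [SemiAnbd] Thm. 6.5 (ii) (F-1658).
[cite: MochizukiEtTh2009, Cor 2.9 p.43] -/
theorem temperedCoverData_cor29_card (hslim : IsSlimGroup M.GtpC)
    (h26 : (e.temperedCoverData ιC hιC hinj op hodd hx hIx hιell hN hY hS hSc).Prop26)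
    (hDc : IsCompact (M.decomp x : Set M.PiTemp)) (h65 : M.toTemperedCurve.DecompCommensurablyTerminal)
    (hfix : ∃ g : M.GtpC, g ∉ M.inclX.range ∧
      g ∈ Subgroup.normalizer (((M.decomp x).map M.inclX : Subgroup M.GtpC) : Set M.GtpC)) :
    (e.temperedCoverData ιC hιC hinj op hodd hx hIx hιell hN hY hS hSc).Cor29_card :=
  (e.temperedCoverData ιC hιC hinj op hodd hx hIx hιell hN hY hS hSc).cor29_card_of hslim h26
    (temperedCoverData_hTheta e ιC hιC hinj op hodd hx hIx hιell hN hY hS hSc)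
    (temperedCoverData_hC1 e ιC hιC hinj op hodd hx hIx hιell hN hY hS hSc hDc h65)
    (temperedCoverData_hC2_of_normalizes e ιC hιC hinj op hodd hx hIx hιell hN hY hS hSc hDc hfix)

/-- **Cor. 2.9 at the model from a continuous section** of `D_x ↠ G_K` (compactness of `D_x` by
`isCompact_decomp_of_section`). [cite: MochizukiEtTh2009, Cor 2.9 p.43] -/
theorem temperedCoverData_cor29_card_of_section (hslim : IsSlimGroup M.GtpC)
    (h26 : (e.temperedCoverData ιC hιC hinj op hodd hx hIx hιell hN hY hS hSc).Prop26)
    (s : ↥M.GK →* M.PiTemp) (hs : ∀ σ, s σ ∈ M.decomp x) (hsa : ∀ σ, M.aug (s σ) = (σ : GQp p))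
    (hsc : Continuous s) (h65 : M.toTemperedCurve.DecompCommensurablyTerminal)
    (hfix : ∃ g : M.GtpC, g ∉ M.inclX.range ∧
      g ∈ Subgroup.normalizer (((M.decomp x).map M.inclX : Subgroup M.GtpC) : Set M.GtpC)) :
    (e.temperedCoverData ιC hιC hinj op hodd hx hIx hιell hN hY hS hSc).Cor29_card :=
  temperedCoverData_cor29_card e ιC hιC hinj op hodd hx hIx hιell hN hY hS hSc hslim h26
    (M.toThetaSetting.isCompact_decomp_of_section hx s hs hsa hsc) h65 hfix

/-! ### v1.1: `hC2` from «`X^log` has a unique cusp» and [SemiAnbd] Thm. 6.5 (iii) -/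

omit [IsTopologicalGroup PC] [T2Space PC] in
/-- **The inversion of `C = X/{±1}` fixes the cusp** — derived form of the origin clause: if `X^log` has a
UNIQUE cusp `x` (type `(1,1)`: a once-punctured elliptic curve) and isomorphisms of `Π^tp_X` preserve cuspidal
decomposition groups ([SemiAnbd] Thm. 6.5 (iii), abc-iut-L3-t2's `IsoPreservesCuspidalDecomp`, FACT-LIST F-1674,
applied to the inner automorphism `conjX ε_±`), then some element of `Π^tp_C ∖ Π^tp_X` normalises `inclX(D_x)`:
`conjX ε_± (D_x)` is a cuspidal decomposition group, hence `= γ D_x γ⁻¹` with `γ ∈ Π^tp_X`, and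
`g := inclX(γ)⁻¹ · ε_±` works. [cite: MochizukiEtTh2009, Def 2.1 p.36] -/
theorem exists_not_mem_range_mem_normalizer_decomp (e : M.CLevelData) {x : M.Pt} (hx : M.IsCusp x)
    (huniq : ∀ x' : M.Pt, M.IsCusp x' → x' = x)
    (h65iii : M.toTemperedCurve.IsoPreservesCuspidalDecomp M.toTemperedCurve) :
    ∃ g : M.GtpC, g ∉ M.inclX.range ∧
      g ∈ Subgroup.normalizer (((M.decomp x).map M.inclX : Subgroup M.GtpC) : Set M.GtpC) := by
  have hcusp : M.toTemperedCurve.IsCuspidalDecompositionGroup (M.decomp x) :=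
    ⟨x, hx, 1, (one_smul _ _).symm⟩
  obtain ⟨x', hx', γ, hγ⟩ := ((h65iii (e.conjX M.epsPM) (M.decomp x)).1 hcusp)
  obtain rfl := huniq x' hx'
  set a : M.PiTemp := ConjAct.ofConjAct γ with ha
  -- `conjX ε (D_x) = a D_x a⁻¹` inside `Π^tp_X`
  have hγ' : (M.decomp x').map (e.conjX M.epsPM).toMulEquiv.toMonoidHom =
      (M.decomp x').map (MulAut.conj a).toMonoidHom := by
    rw [hγ]
    ext y
    rw [Subgroup.mem_smul_pointwise_iff_exists, Subgroup.mem_map]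
    constructor
    · rintro ⟨s, hs, rfl⟩
      exact ⟨s, hs, by rw [ConjAct.smul_def, ← ha]; rfl⟩
    · rintro ⟨s, hs, rfl⟩
      exact ⟨s, hs, by rw [ConjAct.smul_def, ← ha]; rfl⟩
  -- push into `Π^tp_C`: `ε · inclX(D_x) · ε⁻¹ = inclX(a) · inclX(D_x) · inclX(a)⁻¹`
  have hC : ((M.decomp x').map M.inclX).map (MulAut.conj M.epsPM).toMonoidHom =
      ((M.decomp x').map M.inclX).map (MulAut.conj (M.inclX a)).toMonoidHom := by
    rw [← e.map_inclX_map_conjX, hγ', Subgroup.map_map, Subgroup.map_map]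
    congr 1
    ext y
    simp only [MonoidHom.coe_comp, Function.comp_apply, MulEquiv.coe_toMonoidHom, MulAut.conj_apply,
      map_mul, map_inv]
  refine ⟨(M.inclX a)⁻¹ * M.epsPM, fun hmem => M.epsPM_not_mem ?_, ?_⟩
  · have h2 : M.inclX a * ((M.inclX a)⁻¹ * M.epsPM) ∈ M.inclX.range := Subgroup.mul_mem _ ⟨a, rfl⟩ hmem
    rwa [mul_inv_cancel_left] at h2
  · -- equality of conjugates ⇒ normaliser membership
    have hEq : ((M.decomp x').map M.inclX).map (MulAut.conj ((M.inclX a)⁻¹ * M.epsPM)).toMonoidHom =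
        (M.decomp x').map M.inclX := by
      rw [map_mul, MulEquiv.toMonoidHom_eq_coe, MulAut.mul_def]
      show ((M.decomp x').map M.inclX).map
          ((MulAut.conj (M.inclX a)⁻¹).toMonoidHom.comp (MulAut.conj M.epsPM).toMonoidHom) = _
      rw [← Subgroup.map_map, hC, Subgroup.map_map]
      have hid : (MulAut.conj (M.inclX a)⁻¹).toMonoidHom.comp (MulAut.conj (M.inclX a)).toMonoidHom =
          MonoidHom.id _ := by
        ext y; simp [MulAut.conj_apply, mul_assoc]
      rw [hid, Subgroup.map_id]
    rw [Subgroup.mem_normalizer_iff]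
    intro h
    constructor
    · intro hh
      rw [← hEq]
      exact ⟨h, hh, rfl⟩
    · intro hh
      rw [← hEq] at hh
      obtain ⟨h', hh', hhh⟩ := hh
      have : h' = h := by
        have := hhh
        simp only [MulEquiv.coe_toMonoidHom, MulAut.conj_apply, mul_left_inj, mul_right_inj] at this
        exact this
      exact this ▸ hh'

/-- **`hC2` HOLDS at the arithmetic model** modulo the origin clause «`X^log` has a unique cusp» and
[SemiAnbd] Thm. 6.5 (iii) (`IsoPreservesCuspidalDecomp`, F-1674) BY NAME (compact `D_x`): the cusp stabiliser of
the assembled cover is not inside `Π^tp_X`. [cite: MochizukiEtTh2009, Cor 2.9 p.43] -/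
theorem temperedCoverData_hC2 (hDc : IsCompact (M.decomp x : Set M.PiTemp))
    (huniq : ∀ x' : M.Pt, M.IsCusp x' → x' = x)
    (h65iii : M.toTemperedCurve.IsoPreservesCuspidalDecomp M.toTemperedCurve) :
    ¬ (e.temperedCoverData ιC hιC hinj op hodd hx hIx hιell hN hY hS hSc).cuspStabC ≤ (e.temperedCoverData ιC hιC hinj op hodd hx hIx hιell hN hY hS hSc).tp (e.temperedCoverData ιC hιC hinj op hodd hx hIx hιell hN hY hS hSc).PiX :=
  temperedCoverData_hC2_of_normalizes e ιC hιC hinj op hodd hx hIx hιell hN hY hS hSc hDc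
    (e.exists_not_mem_range_mem_normalizer_decomp hx huniq h65iii)

/-- **[EtTh] Cor. 2.9 (all six members) at the arithmetic model, every cusp hypothesis DISCHARGED to NAMED
facts**: residual = {slimness of `Π^tp_C` ([SemiAnbd] §3), Prop. 2.6 (F-0610), [SemiAnbd] Thm. 6.5 (ii) (F-1658)
and (iii) (F-1674), the origin clause «unique cusp», compact `D_x`} — and `μ_l ⊆ K` (`HasMuL`) inside the typed
statement. [cite: MochizukiEtTh2009, Cor 2.9 p.43] -/
theorem temperedCoverData_cor29_card' (hslim : IsSlimGroup M.GtpC) (h26 : (e.temperedCoverData ιC hιC hinj op hodd hx hIx hιell hN hY hS hSc).Prop26)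
    (hDc : IsCompact (M.decomp x : Set M.PiTemp)) (h65 : M.toTemperedCurve.DecompCommensurablyTerminal)
    (huniq : ∀ x' : M.Pt, M.IsCusp x' → x' = x)
    (h65iii : M.toTemperedCurve.IsoPreservesCuspidalDecomp M.toTemperedCurve) : (e.temperedCoverData ιC hιC hinj op hodd hx hIx hιell hN hY hS hSc).Cor29_card :=
  temperedCoverData_cor29_card e ιC hιC hinj op hodd hx hIx hιell hN hY hS hSc hslim h26 hDc h65
    (e.exists_not_mem_range_mem_normalizer_decomp hx huniq h65iii)

/-- **Cor. 2.9 at the model from a continuous section of `D_x ↠ G_K`** (compactness of `D_x` supplied), all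
other cusp hypotheses discharged to named facts as in `temperedCoverData_cor29_card'`.
[cite: MochizukiEtTh2009, Cor 2.9 p.43] -/
theorem temperedCoverData_cor29_card_of_section' (hslim : IsSlimGroup M.GtpC) (h26 : (e.temperedCoverData ιC hιC hinj op hodd hx hIx hιell hN hY hS hSc).Prop26)
    (s : ↥M.GK →* M.PiTemp) (hs : ∀ σ, s σ ∈ M.decomp x) (hsa : ∀ σ, M.aug (s σ) = (σ : GQp p))
    (hsc : Continuous s) (h65 : M.toTemperedCurve.DecompCommensurablyTerminal)
    (huniq : ∀ x' : M.Pt, M.IsCusp x' → x' = x)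
    (h65iii : M.toTemperedCurve.IsoPreservesCuspidalDecomp M.toTemperedCurve) : (e.temperedCoverData ιC hιC hinj op hodd hx hIx hιell hN hY hS hSc).Cor29_card :=
  temperedCoverData_cor29_card' e ιC hιC hinj op hodd hx hIx hιell hN hY hS hSc hslim h26 (M.toThetaSetting.isCompact_decomp_of_section hx s hs hsa hsc)
    h65 huniq h65iii

end Binders

end MuTwoSetting.CLevelData

end Literature.AnabelianGeometry.EtaleTheta
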